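import Summits.CriticalPhenomena.Ising3DConformalLimit.Theses.BallOrbitComparison
import Literature.Probability.LatticeModels.PlusDomainCorrComparison
import HarnessLib
import HarnessLib.Audit

/-!
# Birth skeleton (BC3) for crux `UniformBoundaryForgetting` — item stmt-CriticalPhenomena-5046,
# route `BallOrbitComparison` (rank 4), sub-problem `Ising3DConformalLimit`

Registered file `Cruxes/UniformBoundaryForgetting/Lines/birth.lean`
(planner-skel-stmt-CriticalPhenomena-5046-0, 2026-08-17; route re-audit bin REPAIRABLE).

THE CRUX (by name `BallOrbitComparison.UniformBoundaryForgetting`, grounded g13-40, refuter-checked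
g40-62 and route-review 81cd395a, verdict-vetted 2026-08-16). With `G_Ω^δ = plusDomainCorr 3 Ω δ β_c`
(the route INLINES this object as a `let`; `plusDomainCorr_eq_limUnder` is `rfl`, see
`uniformBoundaryForgetting_iff` below), `ρ_c(δ) = ⟨σ_0 σ_(⌊1/δ⌋e₀)⟩_{β_c}^(-1/2)` and `G = criticalCorr 3`
the bulk `+` state: for every `n`, compact `K ⊆ NonCoincident 3 n`, `ε > 0`,
(FAR SPHERE) `∃ R₀ > 0, ∀ R ≥ R₀, ∀ᶠ δ → 0⁺, ∀ x ∈ K, |ρ_c(δ)ⁿ (G_(B(0,R))^δ − G)([x/δ])| < ε`;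
(SMALL GRAIN) if every `x ∈ K` avoids `0`: `∃ r₀ > 0, ∀ r ∈ (0,r₀], ∀ᶠ δ → 0⁺, ∀ x ∈ K,
|ρ_c(δ)ⁿ (G_({‖y‖ > r})^δ − G)([x/δ])| < ε`.

THE LINE (`birth`: exhaustion ⊕ removable grain, the route's own two-layer plan
`UBF ⇐ FarSphere, SmallGrain`, SHARPENED by the comparison structure of the route). GKS domain
monotonicity is a THEOREM in tree for the very object the crux inlines
(`plusDomainCorr_antitone_set`: `Ω ⊆ Ω' ⇒ G_Ω' ≤ G_Ω` at ALL sites; `criticalCorr_le_plusDomainCorr_apply`: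
`G ≤ G_Ω`; Friedli–Velenik 2017, Exercise 3.12 / Lemma 3.22 in the limit). Hence for nested domains
`0 ≤ ρ_cⁿ(G_Ω' − G) ≤ ρ_cⁿ(G_Ω − G)` (`abs_renorm_diff_lt_of_subset`): the boundary influence of the
+ sphere is MONOTONE in `R` and that of the + grain is MONOTONE in `r`, so each clause of the crux —
uniform over a whole range `R ≥ R₀` / `r ≤ r₀` — is EQUIVALENT to forgetting at ONE radius:

* STUB 1 `stub_farSphereForgetting` — for every `n, K, ε` there is ONE radius `R > 0` with
  `ρ_c(δ)ⁿ (G_(B(0,R))^δ − G)([x/δ]) < ε` for all small `δ`, uniformly in `x ∈ K` (one-sided; the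
  difference is `≥ 0`). This is the uniform-in-mesh decay of the influence of a macroscopic + sphere
  on scale-1 correlations — at `n = 1` exactly "one-arm ≤ ε·√two-point across the scale ratio R"
  (boundary-magnetisation hyperscaling, `ρ_c(δ)⟨σ_[x/δ]⟩⁺_{B(0,R)_δ} < ε`, since `⟨σ⟩_{β_c} = 0` on ℤ³,
  Aizenman–Duminil-Copin–Sidoravicius 2015), open on ℤ³ (arXiv:2406.15243, Open problem 1).
* STUB 2 `stub_smallGrainForgetting` — for every `n`, `K` avoiding `0`, `ε` there is ONE grain radius
  `r > 0` with `ρ_c(δ)ⁿ (G_({‖y‖>r})^δ − G)([x/δ]) < ε` for all small `δ`, uniformly on `K`: the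
  removable-singularity estimate (a + grain of `r/δ` lattice radii seen from distance `≍ 1/δ` acts
  like a σ-insertion of amplitude `≍ r^Δ`), the `ι`-image of STUB 1 in the route's heuristics but NOT a
  formal consequence of it (a ball avoiding `B̄(0,r)` degenerates to a half-space and cannot contain a
  configuration straddling `0`).

COMPOSITION (`UniformBoundaryForgetting_of`, kernel-checked, no `sorry`): unfold the inlined `let`s
(`uniformBoundaryForgetting_iff`, `Iff.rfl`); far sphere: given `R ≥ R₀` use `B(0,R₀) ⊆ B(0,R)`
(`Metric.ball_subset_ball`) and the GKS squeeze; small grain: given `r ∈ (0,r₀]` use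
`{‖y‖ > r₀} ⊆ {‖y‖ > r}` and the same squeeze; `ρ_c(δ)ⁿ ≥ 0` because `ρ_c = 1/√· ≥ 0`.
`UniformBoundaryForgetting_of_stubs : UniformBoundaryForgetting` instantiates it (crux BY NAME).

EXACTNESS (information, sorry-free): `farSphere_of_crux`, `smallGrain_of_crux` (take `R = R₀`,
`r = r₀`, drop `|·|`), hence `crux_iff_stubs : UniformBoundaryForgetting ↔ STUB 1 ∧ STUB 2` — an exact
factorisation along the sphere/grain seam; neither stub implies the other or the crux (BC3 probes).
BC5 (definitions compute): `farSphere_case_zero` proves the `n = 0` instance of STUB 1 outright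
(empty spin monomial, both states give `1`).

DISPROOF USED. No `Cruxes/UniformBoundaryForgetting/Disproof.lean` exists (`ledger crux ls
stmt-CriticalPhenomena-5046`: no workfiles, no crux ideas at registration); `ledger negatives --problem
CriticalPhenomena` (11 refuted statements, all in CardyFormulaZ2 / SAWScalingLimit /
PercolationContinuityZ3) has nothing equal or trivially equivalent to either stub; no landed
`Theorems/UniformBoundaryForgetting/Negative/*`. Barrier honoured: `SlabLimitUniformControl` (uniform
control in an exhaustion parameter can be as hard as the target) is exactly why each stub keeps the
order `∃ radius, ∀ᶠ δ` (radius before mesh) — the monotone reduction removes only the spurious `∀ R ≥ R₀`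
layer, not the uniformity in `δ`.

BC3 PROBES (planner folder `bc/UniformBoundaryForgetting_probes.lean`, imports = this file's imports,
`maxHeartbeats 400000` each): 20 examples = 2 stubs × {→ crux, → `Ising3DConformalLimit`} ×
{`exact?`, `simpa using h`, `simpa [T] using h`, `(unfold T; simpa using h)`, `aesop`} — ALL 20 FAIL
(lean rc 1, one error per example: `exact?` "could not close the goal" ×4, simpa variants "Type
mismatch: After simplification" ×12, aesop "failed to prove the goal after exhaustive search" ×4).
Literal BC form (`bc/UniformBoundaryForgetting_probes_first.lean`,
`first | exact? | simpa [T] | (unfold T; simpa) | aesop`): Q1–Q4 FAIL 4/4 ("unsolved goals"); the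
converses crux → STUB 1/2 (Q5–Q6, true by `farSphere_of_crux`/`smallGrain_of_crux`) also fail cheaply.
STUB 1 lacks the grain clause, STUB 2 the sphere clause, and the summit needs existence of the limit,
Möbius covariance and `U₄ ≢ 0` on top (route items BL, OIR, RV, 0636).

Sorries: exactly two, inside `stub_farSphereForgetting` and `stub_smallGrainForgetting`.
-/

noncomputable section

namespace Summit.CriticalPhenomena.Ising3DConformalLimit.Cruxes.UniformBoundaryForgetting.Birth

open Filter Topology
open scoped Classical
open Literature.Probability.LatticeModels

/-! ## The crux with the Literature names (definitional unfolding of the inlined `let`s) -/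

/-- **The crux, read through `plusDomainCorr`.** The route file inlines
`G Ω δ n y := limUnder atTop (fun L => ⟨∏ σ_yᵢ⟩⁺_{Ω_δ ∩ B(L); β_c})` and `ρ δ := 1/√⟨σ_0σ_(⌊δ⁻¹⌋e₀)⟩_{β_c}`
as `let`s; `plusDomainCorr 3 Ω δ (criticalBeta 3) n y` is the same term (`plusDomainCorr_eq_limUnder`,
`rfl`), so the crux is definitionally the statement below. [folklore] -/
theorem uniformBoundaryForgetting_iff :
    Summit.CriticalPhenomena.Ising3DConformalLimit.Theses.BallOrbitComparison.UniformBoundaryForgetting ↔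
      ∀ (n : ℕ) (K : Set (Fin n → EuclideanSpace ℝ (Fin 3))), IsCompact K →
        K ⊆ NonCoincident 3 n → ∀ ε : ℝ, 0 < ε →
          (∃ R₀ : ℝ, 0 < R₀ ∧ ∀ R, R₀ ≤ R → ∀ᶠ δ in 𝓝[>] (0:ℝ), ∀ x ∈ K,
            |(1 / Real.sqrt (criticalTwoPoint 3 (Pi.single 0 ⌊δ⁻¹⌋))) ^ n *
              (plusDomainCorr 3 (Metric.ball (0 : EuclideanSpace ℝ (Fin 3)) R) δ (criticalBeta 3) n
                  (fun i => latticeApprox δ (x i)) -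
                criticalCorr 3 n (fun i => latticeApprox δ (x i)))| < ε) ∧
          ((∀ x ∈ K, ∀ i, x i ≠ 0) → ∃ r₀ : ℝ, 0 < r₀ ∧ ∀ r ∈ Set.Ioc 0 r₀,
            ∀ᶠ δ in 𝓝[>] (0:ℝ), ∀ x ∈ K,
              |(1 / Real.sqrt (criticalTwoPoint 3 (Pi.single 0 ⌊δ⁻¹⌋))) ^ n *
                (plusDomainCorr 3 {y : EuclideanSpace ℝ (Fin 3) | r < ‖y‖} δ (criticalBeta 3) n
                    (fun i => latticeApprox δ (x i)) -
                  criticalCorr 3 n (fun i => latticeApprox δ (x i)))| < ε) :=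
  Iff.rfl

/-! ## The two registered stubs -/

/-- **STUB 1 — far + sphere forgotten at ONE radius, uniformly in the mesh ("FarSphere" of the
route's two-layer plan, sharpened by GKS monotonicity in `R`).** For every `n`, every compact
`K ⊆ NonCoincident 3 n` and `ε > 0` there is a radius `R > 0` such that for all sufficiently small
`δ > 0` and all `x ∈ K`, `ρ_c(δ)ⁿ (⟨∏σ_[xᵢ/δ]⟩⁺_{B(0,R)_δ;β_c} − ⟨∏σ_[xᵢ/δ]⟩⁺_{β_c}) < ε` (the difference
is `≥ 0` by GKS, `criticalCorr_le_plusDomainCorr_apply`). Uniform-in-mesh polynomial-type decay of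
the influence of a macroscopic + seed across the scale ratio `R` (FK-Ising one-arm / boundary
magnetisation hyperscaling at `n = 1`); open on `ℤ³` even without uniformity beyond the rate-free
continuity of Aizenman–Duminil-Copin–Sidoravicius 2015 (arXiv:2406.15243, §1.4, Open problem 1).
[cite: FriedliVelenik2017, Exercise 3.12, p. 112] -/
theorem stub_farSphereForgetting :
    ∀ (n : ℕ) (K : Set (Fin n → EuclideanSpace ℝ (Fin 3))), IsCompact K →
      K ⊆ NonCoincident 3 n → ∀ ε : ℝ, 0 < ε →
        ∃ R : ℝ, 0 < R ∧ ∀ᶠ δ in 𝓝[>] (0:ℝ), ∀ x ∈ K,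
          (1 / Real.sqrt (criticalTwoPoint 3 (Pi.single 0 ⌊δ⁻¹⌋))) ^ n *
            (plusDomainCorr 3 (Metric.ball (0 : EuclideanSpace ℝ (Fin 3)) R) δ (criticalBeta 3) n
                (fun i => latticeApprox δ (x i)) -
              criticalCorr 3 n (fun i => latticeApprox δ (x i))) < ε := by
  sorry

/-- **STUB 2 — small + grain forgotten at ONE grain radius, uniformly in the mesh ("SmallGrain" of
the route's two-layer plan, sharpened by GKS monotonicity in `r`).** For every `n`, every compact
`K ⊆ NonCoincident 3 n` whose configurations avoid `0` and every `ε > 0` there is `r > 0` such that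
for all sufficiently small `δ > 0` and all `x ∈ K`,
`ρ_c(δ)ⁿ (⟨∏σ_[xᵢ/δ]⟩⁺_{{‖y‖>r}_δ;β_c} − ⟨∏σ_[xᵢ/δ]⟩⁺_{β_c}) < ε` — a + grain of `r/δ` lattice radii at the
origin is a removable singularity for the renormalised correlations at scale `1` (expected influence
`≍ r^Δ`; Loewner–Nirenberg removability of point singularities in `d = 3` on the route card). The
`ι`-image of STUB 1 heuristically, not formally. Open on `ℤ³`.
[cite: FriedliVelenik2017, Exercise 3.12, p. 112] -/
theorem stub_smallGrainForgetting :
    ∀ (n : ℕ) (K : Set (Fin n → EuclideanSpace ℝ (Fin 3))), IsCompact K →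
      K ⊆ NonCoincident 3 n → (∀ x ∈ K, ∀ i, x i ≠ 0) → ∀ ε : ℝ, 0 < ε →
        ∃ r : ℝ, 0 < r ∧ ∀ᶠ δ in 𝓝[>] (0:ℝ), ∀ x ∈ K,
          (1 / Real.sqrt (criticalTwoPoint 3 (Pi.single 0 ⌊δ⁻¹⌋))) ^ n *
            (plusDomainCorr 3 {y : EuclideanSpace ℝ (Fin 3) | r < ‖y‖} δ (criticalBeta 3) n
                (fun i => latticeApprox δ (x i)) -
              criticalCorr 3 n (fun i => latticeApprox δ (x i))) < ε := by
  sorry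

/-! ## Sorry-free glue: the GKS squeeze -/

/-- The canonical renormalisation `ρ_c(δ) = 1/√⟨σ_0 σ_(⌊δ⁻¹⌋e₀)⟩_{β_c}` is `≥ 0` (a reciprocal square
root; `1/0 = 0`), hence so is `ρ_c(δ)ⁿ`. [folklore] -/
theorem rhoC_pow_nonneg (δ : ℝ) (n : ℕ) :
    0 ≤ (1 / Real.sqrt (criticalTwoPoint 3 (Pi.single 0 ⌊δ⁻¹⌋))) ^ n :=
  pow_nonneg (one_div_nonneg.2 (Real.sqrt_nonneg _)) n

/-- **GKS squeeze (the comparison structure of the route).** For nested domains `Ω ⊆ Ω'`, any mesh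
`δ`, any sites `y` and any `c ≥ 0`:
`0 ≤ c·(⟨∏σ_y⟩⁺_{Ω'_δ;β_c} − ⟨∏σ_y⟩⁺_{β_c}) ≤ c·(⟨∏σ_y⟩⁺_{Ω_δ;β_c} − ⟨∏σ_y⟩⁺_{β_c})` — the bulk + state lies
below every + domain state (`criticalCorr_le_plusDomainCorr_apply`) and + domain states are antitone
in the domain (`plusDomainCorr_antitone_set`; Friedli–Velenik 2017, Exercise 3.12 / Lemma 3.22 in the
limit). So smallness of the renormalised boundary influence of `Ω` transfers to every `Ω' ⊇ Ω`.
[cite: FriedliVelenik2017, Exercise 3.12, p. 112] -/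
theorem abs_renorm_diff_lt_of_subset {Ω Ω' : Set (EuclideanSpace ℝ (Fin 3))} (hΩ : Ω ⊆ Ω')
    {δ c ε : ℝ} (hc : 0 ≤ c) {n : ℕ} {y : Fin n → Site 3}
    (h : c * (plusDomainCorr 3 Ω δ (criticalBeta 3) n y - criticalCorr 3 n y) < ε) :
    |c * (plusDomainCorr 3 Ω' δ (criticalBeta 3) n y - criticalCorr 3 n y)| < ε := by
  have h1 : criticalCorr 3 n y ≤ plusDomainCorr 3 Ω' δ (criticalBeta 3) n y :=
    criticalCorr_le_plusDomainCorr_apply Ω' δ y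
  have h2 : plusDomainCorr 3 Ω' δ (criticalBeta 3) n y ≤ plusDomainCorr 3 Ω δ (criticalBeta 3) n y :=
    plusDomainCorr_antitone_set (criticalBeta_nonneg 3) δ y hΩ
  rw [abs_of_nonneg (mul_nonneg hc (sub_nonneg.2 h1))]
  exact lt_of_le_of_lt (mul_le_mul_of_nonneg_left (sub_le_sub_right h2 _) hc) h

/-! ## The composition -/

/-- **THE SKELETON THEOREM** — `UniformBoundaryForgetting` from the two stubs (their signatures are
the explicit hypotheses; no `sorry`). Far sphere: for `R ≥ R₀`, `B(0,R₀) ⊆ B(0,R)` and the GKS squeeze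
turn forgetting at the single radius `R₀` into forgetting at every `R ≥ R₀`, with the same
`δ`-threshold; small grain: for `r ∈ (0,r₀]`, `{‖y‖ > r₀} ⊆ {‖y‖ > r}` likewise. (Friedli–Velenik 2017,
Exercise 3.12 / Lemma 3.22; the route's support item GKSDomainMonotonicity.) [folklore] -/
theorem UniformBoundaryForgetting_of
    (hfar : ∀ (n : ℕ) (K : Set (Fin n → EuclideanSpace ℝ (Fin 3))), IsCompact K →
      K ⊆ NonCoincident 3 n → ∀ ε : ℝ, 0 < ε →
        ∃ R : ℝ, 0 < R ∧ ∀ᶠ δ in 𝓝[>] (0:ℝ), ∀ x ∈ K,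
          (1 / Real.sqrt (criticalTwoPoint 3 (Pi.single 0 ⌊δ⁻¹⌋))) ^ n *
            (plusDomainCorr 3 (Metric.ball (0 : EuclideanSpace ℝ (Fin 3)) R) δ (criticalBeta 3) n
                (fun i => latticeApprox δ (x i)) -
              criticalCorr 3 n (fun i => latticeApprox δ (x i))) < ε)
    (hgrain : ∀ (n : ℕ) (K : Set (Fin n → EuclideanSpace ℝ (Fin 3))), IsCompact K →
      K ⊆ NonCoincident 3 n → (∀ x ∈ K, ∀ i, x i ≠ 0) → ∀ ε : ℝ, 0 < ε →
        ∃ r : ℝ, 0 < r ∧ ∀ᶠ δ in 𝓝[>] (0:ℝ), ∀ x ∈ K,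
          (1 / Real.sqrt (criticalTwoPoint 3 (Pi.single 0 ⌊δ⁻¹⌋))) ^ n *
            (plusDomainCorr 3 {y : EuclideanSpace ℝ (Fin 3) | r < ‖y‖} δ (criticalBeta 3) n
                (fun i => latticeApprox δ (x i)) -
              criticalCorr 3 n (fun i => latticeApprox δ (x i))) < ε) :
    Summit.CriticalPhenomena.Ising3DConformalLimit.Theses.BallOrbitComparison.UniformBoundaryForgetting := by
  rw [uniformBoundaryForgetting_iff]
  intro n K hK hKnc ε hε
  refine ⟨?_, fun h0 => ?_⟩
  · -- far sphere: one radius `R₀` from STUB 1, every `R ≥ R₀` by the GKS squeeze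
    obtain ⟨R₀, hR₀, hev⟩ := hfar n K hK hKnc ε hε
    refine ⟨R₀, hR₀, fun R hR => ?_⟩
    filter_upwards [hev] with δ hδ x hx
    exact abs_renorm_diff_lt_of_subset (Metric.ball_subset_ball hR) (rhoC_pow_nonneg δ n) (hδ x hx)
  · -- small grain: one grain radius `r₀` from STUB 2, every `r ∈ (0, r₀]` by the GKS squeeze
    obtain ⟨r₀, hr₀, hev⟩ := hgrain n K hK hKnc h0 ε hε
    refine ⟨r₀, hr₀, fun r hr => ?_⟩
    filter_upwards [hev] with δ hδ x hx
    exact abs_renorm_diff_lt_of_subset (fun y (hy : r₀ < ‖y‖) => lt_of_le_of_lt hr.2 hy)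
      (rhoC_pow_nonneg δ n) (hδ x hx)

/-- The crux BY NAME from the two registered stubs. [folklore] -/
theorem UniformBoundaryForgetting_of_stubs :
    Summit.CriticalPhenomena.Ising3DConformalLimit.Theses.BallOrbitComparison.UniformBoundaryForgetting :=
  UniformBoundaryForgetting_of stub_farSphereForgetting stub_smallGrainForgetting

/-! ## Exactness of the split (information): each stub is necessary -/

/-- crux ⇒ STUB 1: take `R = R₀` and drop the absolute value. [folklore] -/
theorem farSphere_of_crux
    (h : Summit.CriticalPhenomena.Ising3DConformalLimit.Theses.BallOrbitComparison.UniformBoundaryForgetting) :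
    ∀ (n : ℕ) (K : Set (Fin n → EuclideanSpace ℝ (Fin 3))), IsCompact K →
      K ⊆ NonCoincident 3 n → ∀ ε : ℝ, 0 < ε →
        ∃ R : ℝ, 0 < R ∧ ∀ᶠ δ in 𝓝[>] (0:ℝ), ∀ x ∈ K,
          (1 / Real.sqrt (criticalTwoPoint 3 (Pi.single 0 ⌊δ⁻¹⌋))) ^ n *
            (plusDomainCorr 3 (Metric.ball (0 : EuclideanSpace ℝ (Fin 3)) R) δ (criticalBeta 3) n
                (fun i => latticeApprox δ (x i)) -
              criticalCorr 3 n (fun i => latticeApprox δ (x i))) < ε := by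
  rw [uniformBoundaryForgetting_iff] at h
  intro n K hK hKnc ε hε
  obtain ⟨R₀, hR₀, hall⟩ := (h n K hK hKnc ε hε).1
  refine ⟨R₀, hR₀, ?_⟩
  filter_upwards [hall R₀ le_rfl] with δ hδ x hx
  exact lt_of_abs_lt (hδ x hx)

/-- crux ⇒ STUB 2: take `r = r₀` and drop the absolute value. [folklore] -/
theorem smallGrain_of_crux
    (h : Summit.CriticalPhenomena.Ising3DConformalLimit.Theses.BallOrbitComparison.UniformBoundaryForgetting) :
    ∀ (n : ℕ) (K : Set (Fin n → EuclideanSpace ℝ (Fin 3))), IsCompact K →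
      K ⊆ NonCoincident 3 n → (∀ x ∈ K, ∀ i, x i ≠ 0) → ∀ ε : ℝ, 0 < ε →
        ∃ r : ℝ, 0 < r ∧ ∀ᶠ δ in 𝓝[>] (0:ℝ), ∀ x ∈ K,
          (1 / Real.sqrt (criticalTwoPoint 3 (Pi.single 0 ⌊δ⁻¹⌋))) ^ n *
            (plusDomainCorr 3 {y : EuclideanSpace ℝ (Fin 3) | r < ‖y‖} δ (criticalBeta 3) n
                (fun i => latticeApprox δ (x i)) -
              criticalCorr 3 n (fun i => latticeApprox δ (x i))) < ε := by
  rw [uniformBoundaryForgetting_iff] at h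
  intro n K hK hKnc h0 ε hε
  obtain ⟨r₀, hr₀, hall⟩ := (h n K hK hKnc ε hε).2 h0
  refine ⟨r₀, hr₀, ?_⟩
  filter_upwards [hall r₀ ⟨hr₀, le_rfl⟩] with δ hδ x hx
  exact lt_of_abs_lt (hδ x hx)

/-- **The split is exact**: given the tree's GKS comparison theorems the crux is EQUIVALENT to
STUB 1 ∧ STUB 2 (sphere/grain seam). [folklore] -/
theorem crux_iff_stubs :
    Summit.CriticalPhenomena.Ising3DConformalLimit.Theses.BallOrbitComparison.UniformBoundaryForgetting ↔
      ((∀ (n : ℕ) (K : Set (Fin n → EuclideanSpace ℝ (Fin 3))), IsCompact K →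
        K ⊆ NonCoincident 3 n → ∀ ε : ℝ, 0 < ε →
          ∃ R : ℝ, 0 < R ∧ ∀ᶠ δ in 𝓝[>] (0:ℝ), ∀ x ∈ K,
            (1 / Real.sqrt (criticalTwoPoint 3 (Pi.single 0 ⌊δ⁻¹⌋))) ^ n *
              (plusDomainCorr 3 (Metric.ball (0 : EuclideanSpace ℝ (Fin 3)) R) δ (criticalBeta 3) n
                  (fun i => latticeApprox δ (x i)) -
                criticalCorr 3 n (fun i => latticeApprox δ (x i))) < ε) ∧
      (∀ (n : ℕ) (K : Set (Fin n → EuclideanSpace ℝ (Fin 3))), IsCompact K →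
        K ⊆ NonCoincident 3 n → (∀ x ∈ K, ∀ i, x i ≠ 0) → ∀ ε : ℝ, 0 < ε →
          ∃ r : ℝ, 0 < r ∧ ∀ᶠ δ in 𝓝[>] (0:ℝ), ∀ x ∈ K,
            (1 / Real.sqrt (criticalTwoPoint 3 (Pi.single 0 ⌊δ⁻¹⌋))) ^ n *
              (plusDomainCorr 3 {y : EuclideanSpace ℝ (Fin 3) | r < ‖y‖} δ (criticalBeta 3) n
                  (fun i => latticeApprox δ (x i)) -
                criticalCorr 3 n (fun i => latticeApprox δ (x i))) < ε)) :=
  ⟨fun h => ⟨farSphere_of_crux h, smallGrain_of_crux h⟩, fun h => UniformBoundaryForgetting_of h.1 h.2⟩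

/-! ## BC5: the definitions compute — the `n = 0` instance of STUB 1 -/

/-- The empty spin monomial has expectation `1` in every + domain state (probability measures, a
constant box sequence). [folklore] -/
theorem plusDomainCorr_fin_zero (Ω : Set (EuclideanSpace ℝ (Fin 3))) (δ β : ℝ) (y : Fin 0 → Site 3) :
    plusDomainCorr 3 Ω δ β 0 y = 1 := by
  have hm : spinMonomial y = fun _ => (1 : ℝ) := by
    funext s
    simp [spinMonomial]
  have hc : ∀ L : ℕ,
      isingExpect (zdGraph 3) (domainBox Ω δ L) β 0 .plus (spinMonomial y) = 1 := by
    intro L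
    rw [hm]
    simp [isingExpect]
  show limUnder atTop
      (fun L : ℕ => isingExpect (zdGraph 3) (domainBox Ω δ L) β 0 .plus (spinMonomial y)) = 1
  simp only [hc]
  exact tendsto_const_nhds.limUnder_eq

/-- **BC5 special case (`n = 0` of STUB 1, sorry-free)**: with no spins both states give `1`, the
renormalised difference is `0 < ε`; any radius works. [folklore] -/
theorem farSphere_case_zero (K : Set (Fin 0 → EuclideanSpace ℝ (Fin 3))) (ε : ℝ) (hε : 0 < ε) :
    ∃ R : ℝ, 0 < R ∧ ∀ᶠ δ in 𝓝[>] (0:ℝ), ∀ x ∈ K,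
      (1 / Real.sqrt (criticalTwoPoint 3 (Pi.single 0 ⌊δ⁻¹⌋))) ^ (0:ℕ) *
        (plusDomainCorr 3 (Metric.ball (0 : EuclideanSpace ℝ (Fin 3)) R) δ (criticalBeta 3) 0
            (fun i => latticeApprox δ (x i)) -
          criticalCorr 3 0 (fun i => latticeApprox δ (x i))) < ε := by
  refine ⟨1, one_pos, Filter.Eventually.of_forall fun δ x _ => ?_⟩
  have h1 := plusDomainCorr_fin_zero (Metric.ball (0 : EuclideanSpace ℝ (Fin 3)) 1) δ (criticalBeta 3)
    (fun i => latticeApprox δ (x i))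
  have h2 : criticalCorr 3 0 (fun i => latticeApprox δ (x i)) = 1 := by
    rw [← plusDomainCorr_univ_criticalBeta δ]
    exact plusDomainCorr_fin_zero _ δ _ _
  rw [h1, h2]
  simpa using hε

end Summit.CriticalPhenomena.Ising3DConformalLimit.Cruxes.UniformBoundaryForgetting.Birth

end
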